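import Literature.Analysis.Calculus.AnalyticRootFunctions
import Mathlib.Data.Finset.Sort
import Mathlib.Topology.Order.IntermediateValue
import HarnessLib

/-!
# Real structure of analytic root functions: conjugate pairs, real walls, midpoints

Continuation of `Literature/Analysis/Calculus/AnalyticRootFunctions.lean`. Let `V` be open and
preconnected in a real normed space, `Ω ⊆ V` open, non-empty and preconnected, and
`ζ₁, …, ζₙ : V → ℂ` real-analytic with pairwise distinct values at every point of `Ω` and such that
at every point of `Ω` the set of values is closed under complex conjugation (the roots of a REAL
polynomial with simple roots over `Ω`). Then:

* `exists_conj_perm` — conjugation is realised by a fixed involution `τ` of the indices: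
  `conj ∘ ζ_l = ζ_{τ l}` on all of `V`;
* a root function is real-valued on all of `V` iff `τ l = l`, and otherwise has non-zero imaginary
  part at every point of `Ω` (`im_eq_zero_of_perm_eq`, `im_ne_zero_of_perm_ne`);
* `exists_strictMono_walls` — the real-valued root functions ("walls") are enumerated by an
  injection `r : Fin p → Fin n` which is increasing at EVERY point of `Ω` (they never cross on the
  connected `Ω`), and the real roots over `σ ∈ Ω` are exactly the `ζ_{r m} σ`;
* `exists_re_eq_wall` — if moreover the values over `Ω` of a `τ`-stable subfamily `S` have all
  their pairwise midpoints among the values (midpoint augmentation), then the real part of every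
  `ζ_l`, `l ∈ S`, IS a wall: `re ζ_l = ζ_{r m}` on `V`.

All proofs are selections of root functions (`exists_eqOn_of_forall_exists_eq`) plus the
intermediate value theorem on `Ω`.

## References

* H. W. E. Jung, J. reine angew. Math. 133 (1908), 289–314.
* J. Kollár, *Lectures on Resolution of Singularities* (2007), §2.3.
-/

noncomputable section

open Set Filter
open scoped Topology ComplexConjugate

namespace Literature.Analysis.Calculus

section Elementary

variable {E : Type*} {V Ω : Set E} {n : ℕ} {ζ : Fin n → E → ℂ}

/-- A root function fixed by the conjugation involution is real-valued on `V`. [folklore] -/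
theorem im_eq_zero_of_perm_eq {τ : Fin n → Fin n} (hτ : ∀ l, ∀ σ ∈ V, conj (ζ l σ) = ζ (τ l) σ)
    {l : Fin n} (hl : τ l = l) {σ : E} (hσ : σ ∈ V) : (ζ l σ).im = 0 := by
  have h := hτ l σ hσ
  rw [hl] at h
  exact Complex.conj_eq_iff_im.1 h

/-- A root function moved by the conjugation involution is non-real at every point of `Ω`.
[folklore] -/
theorem im_ne_zero_of_perm_ne (hΩV : Ω ⊆ V) (hdist : ∀ σ ∈ Ω, Function.Injective fun l => ζ l σ)
    {τ : Fin n → Fin n} (hτ : ∀ l, ∀ σ ∈ V, conj (ζ l σ) = ζ (τ l) σ) {l : Fin n} (hl : τ l ≠ l)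
    {σ : E} (hσ : σ ∈ Ω) : (ζ l σ).im ≠ 0 := by
  intro him
  apply hl
  apply hdist σ hσ
  simp only
  rw [← hτ l σ (hΩV hσ), Complex.conj_eq_iff_im.2 him]

end Elementary

section IVT

variable {E : Type*} [TopologicalSpace E] {Ω : Set E}

/-- On a preconnected set, a continuous real function without zeros which is positive at one point
is positive everywhere (intermediate value theorem). [folklore] -/
theorem pos_of_isPreconnected {f : E → ℝ} (hΩc : IsPreconnected Ω) (hf : ContinuousOn f Ω)
    (hne : ∀ σ ∈ Ω, f σ ≠ 0) {σ₀ : E} (hσ₀ : σ₀ ∈ Ω) (hpos : 0 < f σ₀) {σ : E} (hσ : σ ∈ Ω) :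
    0 < f σ := by
  by_contra h
  push Not at h
  obtain ⟨x, hx, hx0⟩ := hΩc.intermediate_value hσ hσ₀ hf ⟨h, hpos.le⟩
  exact hne x hx hx0

end IVT

variable {E : Type*} [NormedAddCommGroup E] [NormedSpace ℝ E] {V Ω : Set E} {n : ℕ}
  {ζ : Fin n → E → ℂ}

/-- The complex conjugate of a real-analytic function (of a real variable) is real-analytic.
[folklore] -/
theorem analyticOnNhd_conj {f : E → ℂ} {s : Set E} (hf : AnalyticOnNhd ℝ f s) :
    AnalyticOnNhd ℝ (fun σ => conj (f σ)) s := fun σ hσ =>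
  ((Complex.conjCLE : ℂ →L[ℝ] ℂ).analyticAt _).comp (hf σ hσ)

/-- The real part of a real-analytic function is real-analytic. [folklore] -/
theorem analyticOnNhd_re {f : E → ℂ} {s : Set E} (hf : AnalyticOnNhd ℝ f s) :
    AnalyticOnNhd ℝ (fun σ => (f σ).re) s := fun σ hσ =>
  (Complex.reCLM.analyticAt _).comp (hf σ hσ)

/-- **Conjugation permutes analytic root functions.** If the values `ζ_l σ` are pairwise distinct
and closed under conjugation at every point of the non-empty open `Ω ⊆ V` (`V` preconnected), then
there is an involution `τ` of the indices with `conj (ζ_l σ) = ζ_{τ l} σ` for all `σ ∈ V`.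
[folklore] -/
theorem exists_conj_perm (hV : IsPreconnected V) (hΩV : Ω ⊆ V) (hΩ : IsOpen Ω) (hne : Ω.Nonempty)
    (hζ : ∀ l, AnalyticOnNhd ℝ (ζ l) V) (hdist : ∀ σ ∈ Ω, Function.Injective fun l => ζ l σ)
    (hconj : ∀ σ ∈ Ω, ∀ l, ∃ l', conj (ζ l σ) = ζ l' σ) :
    ∃ τ : Fin n → Fin n, (∀ l, ∀ σ ∈ V, conj (ζ l σ) = ζ (τ l) σ) ∧ ∀ l, τ (τ l) = l := by
  have h : ∀ l, ∃ l', EqOn (fun σ => conj (ζ l σ)) (ζ l') V := fun l =>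
    exists_eqOn_of_forall_exists_eq hV hΩV hΩ hne hζ (analyticOnNhd_conj (hζ l)) (hconj · · l)
  choose τ hτ using h
  obtain ⟨σ₀, hσ₀⟩ := hne
  refine ⟨τ, fun l σ hσ => hτ l hσ, fun l => hdist σ₀ hσ₀ ?_⟩
  have h1 := hτ (τ l) (hΩV hσ₀)
  have h2 := hτ l (hΩV hσ₀)
  simp only at h1 h2 ⊢
  rw [← h1, ← h2, Complex.conj_conj]

/-- **The real walls.** Under the hypotheses of `exists_conj_perm`, with `Ω` preconnected: the
real-valued root functions are enumerated by an injection `r : Fin p → Fin n` such that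
`σ ↦ (re ζ_{r 0} σ < ⋯ < re ζ_{r (p-1)} σ)` is strictly increasing at every point of `Ω`, every
index fixed by `τ` is in the range of `r`, and the real roots over `σ ∈ Ω` are exactly the values
`re ζ_{r m} σ`. [folklore] -/
theorem exists_strictMono_walls (hΩV : Ω ⊆ V) (hΩc : IsPreconnected Ω) (hne : Ω.Nonempty)
    (hζ : ∀ l, AnalyticOnNhd ℝ (ζ l) V) (hdist : ∀ σ ∈ Ω, Function.Injective fun l => ζ l σ)
    {τ : Fin n → Fin n} (hτ : ∀ l, ∀ σ ∈ V, conj (ζ l σ) = ζ (τ l) σ) :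
    ∃ (p : ℕ) (r : Fin p → Fin n), Function.Injective r ∧ (∀ m, τ (r m) = r m) ∧
      (∀ l, τ l = l → ∃ m, r m = l) ∧
      (∀ σ ∈ Ω, StrictMono fun m => (ζ (r m) σ).re) ∧
      ∀ σ ∈ Ω, ∀ t : ℝ, (∃ l, (t : ℂ) = ζ l σ) ↔ ∃ m, t = (ζ (r m) σ).re := by
  classical
  obtain ⟨σ₀, hσ₀⟩ := hne
  set Lr : Finset (Fin n) := Finset.univ.filter fun l => τ l = l with hLr
  set v : Fin n → ℝ := fun l => (ζ l σ₀).re with hv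
  have hreal : ∀ l ∈ Lr, ∀ σ ∈ V, ((ζ l σ).re : ℂ) = ζ l σ := fun l hl σ hσ => by
    rw [hLr, Finset.mem_filter] at hl
    exact Complex.ext rfl (by simp [im_eq_zero_of_perm_eq hτ hl.2 hσ])
  have hvinj : Set.InjOn v Lr := fun l hl l' hl' h => hdist σ₀ hσ₀ (by
    simp only
    rw [← hreal l hl σ₀ (hΩV hσ₀), ← hreal l' hl' σ₀ (hΩV hσ₀)]
    exact congrArg _ h)
  set s : Finset ℝ := Lr.image v with hs
  set p := s.card with hp
  have hmem : ∀ m : Fin p, ∃ l ∈ Lr, v l = s.orderEmbOfFin rfl m := fun m =>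
    Finset.mem_image.1 (s.orderEmbOfFin_mem rfl m)
  choose r hrL hrv using hmem
  have hr_fix : ∀ m, τ (r m) = r m := fun m => (Finset.mem_filter.1 (hrL m)).2
  have hmono₀ : StrictMono fun m => v (r m) := fun m m' h => by
    simp only [hrv]
    exact (s.orderEmbOfFin rfl).strictMono h
  have hrinj : Function.Injective r := fun m m' h =>
    hmono₀.injective (by simp only [h])
  -- the walls never cross on `Ω`
  have hcont : ∀ l, ContinuousOn (fun σ => (ζ l σ).re) Ω := fun l =>
    (analyticOnNhd_re (hζ l)).continuousOn.mono hΩV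
  have hmono : ∀ σ ∈ Ω, StrictMono fun m => (ζ (r m) σ).re := by
    intro σ hσ m m' hmm'
    have hδ := pos_of_isPreconnected (f := fun σ => (ζ (r m') σ).re - (ζ (r m) σ).re) hΩc
      ((hcont _).sub (hcont _)) (fun x hx h0 => ?_) hσ₀ (sub_pos.2 (hmono₀ hmm')) hσ
    · simpa only [sub_pos] using hδ
    · have h1 : ζ (r m') x = ζ (r m) x := by
        rw [← hreal _ (hrL m') x (hΩV hx), ← hreal _ (hrL m) x (hΩV hx)]
        exact congrArg _ (sub_eq_zero.1 h0)
      exact absurd (hrinj (hdist x hx h1)) (ne_of_lt hmm').symm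
  refine ⟨p, r, hrinj, hr_fix, fun l hl => ?_, hmono, fun σ hσ t => ⟨?_, ?_⟩⟩
  · have hlL : l ∈ Lr := Finset.mem_filter.2 ⟨Finset.mem_univ _, hl⟩
    have hvs : v l ∈ Set.range (s.orderEmbOfFin rfl) := by
      rw [Finset.range_orderEmbOfFin]
      exact Finset.mem_image_of_mem v hlL
    obtain ⟨m, hm⟩ := hvs
    exact ⟨m, hvinj (hrL m) hlL (by rw [hrv m, hm])⟩
  · rintro ⟨l, hl⟩
    have hfix : τ l = l := by
      by_contra h
      exact im_ne_zero_of_perm_ne hΩV hdist hτ h hσ (by rw [← hl]; simp)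
    have hlL : l ∈ Lr := Finset.mem_filter.2 ⟨Finset.mem_univ _, hfix⟩
    have hvs : v l ∈ Set.range (s.orderEmbOfFin rfl) := by
      rw [Finset.range_orderEmbOfFin]
      exact Finset.mem_image_of_mem v hlL
    obtain ⟨m, hm⟩ := hvs
    have hlm : r m = l := hvinj (hrL m) hlL (by rw [hrv m, hm])
    exact ⟨m, by rw [hlm, ← hl]; simp⟩
  · rintro ⟨m, rfl⟩
    exact ⟨r m, hreal _ (hrL m) σ (hΩV hσ)⟩

/-- **Real parts of augmented roots are walls.** In the situation of `exists_strictMono_walls`,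
let `S` be a `τ`-stable set of indices such that over every point of `Ω` the midpoint of any two
values `ζ_l σ`, `ζ_{l'} σ` (`l, l' ∈ S`) is again one of the values `ζ_{l''} σ`. Then for every
`l ∈ S` the real part `re ζ_l` coincides on `V` with a wall `ζ_{r m}`. [folklore] -/
theorem exists_re_eq_wall (hV : IsPreconnected V) (hΩV : Ω ⊆ V) (hΩ : IsOpen Ω) (hne : Ω.Nonempty)
    (hζ : ∀ l, AnalyticOnNhd ℝ (ζ l) V) (hdist : ∀ σ ∈ Ω, Function.Injective fun l => ζ l σ)
    {τ : Fin n → Fin n} (hτ : ∀ l, ∀ σ ∈ V, conj (ζ l σ) = ζ (τ l) σ)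
    {p : ℕ} {r : Fin p → Fin n} (hr : ∀ l, τ l = l → ∃ m, r m = l)
    {S : Set (Fin n)} (hS : ∀ l ∈ S, τ l ∈ S)
    (hmid : ∀ σ ∈ Ω, ∀ l ∈ S, ∀ l' ∈ S, ∃ l'', ζ l σ + ζ l' σ = 2 * ζ l'' σ)
    {l : Fin n} (hl : l ∈ S) :
    ∃ m, ∀ σ ∈ V, ((ζ l σ).re : ℂ) = ζ (r m) σ := by
  set g : E → ℂ := fun σ => (ζ l σ + ζ (τ l) σ) / 2 with hg
  have hga : AnalyticOnNhd ℝ g V := fun σ hσ =>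
    (((hζ l) σ hσ).add ((hζ (τ l)) σ hσ)).div analyticAt_const two_ne_zero
  obtain ⟨l'', hl''⟩ := exists_eqOn_of_forall_exists_eq hV hΩV hΩ hne hζ hga (fun σ hσ => by
    obtain ⟨l'', h⟩ := hmid σ hσ l hl (τ l) (hS l hl)
    exact ⟨l'', by rw [hg]; simp only; rw [h]; ring⟩)
  have hgre : ∀ σ ∈ V, g σ = ((ζ l σ).re : ℂ) := fun σ hσ => by
    rw [hg]
    simp only
    rw [← hτ l σ hσ, Complex.add_conj, Complex.ofReal_mul, Complex.ofReal_ofNat]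
    ring
  obtain ⟨σ₀, hσ₀⟩ := hne
  have hfix : τ l'' = l'' := by
    by_contra h
    apply im_ne_zero_of_perm_ne hΩV hdist hτ h hσ₀
    rw [← hl'' (hΩV hσ₀), hgre σ₀ (hΩV hσ₀), Complex.ofReal_im]
  obtain ⟨m, hm⟩ := hr l'' hfix
  exact ⟨m, fun σ hσ => by rw [hm, ← hgre σ hσ, hl'' hσ]⟩

end Literature.Analysis.Calculus
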